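import Literature.Barriers.CriticalPhenomena.PlaquetteWalkHoleRootExtremeRowGap
import HarnessLib

/-!
# Barrier catalogue (SAWScalingLimit): the shape of the extreme runs of a low-cost wound walk — entry turn, straight interior, exit turn;
EXACTLY two isolated turns per extreme row at cost `≤ 6` («EXTREME RUN SHAPE»)

Second structural brick of the «RECTANGLE COEFFICIENT» classification (after `PlaquetteWalkHoleRootExtremeRowGap`: at limit cost `≤ 6`
each extreme row of a wound class-`B2a` walk from a `W`-normalised hole root is one run, with no sideways end).

* `YBWalk.exists_fc_eq_of_mem_facesL` — a visited plaquette is the plaquette of an arc (index form).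
* ★★★ `ΩG.top_run_shape` / `ΩG.bottom_run_shape`: at cost `≤ 6` the topmost (bottommost) row is visited exactly by the arcs
  `j₀ ≤ m ≤ i₁` of ONE run, `1 ≤ j₀ < i₁`; its first arc ENTERS vertically and turns sideways (`S → W/E`, resp. `N → W/E`), its last
  arc EXITS vertically (`W/E → S`, resp. `W/E → N`; it may be the walk's last arc), every arc strictly between is STRAIGHT horizontal,
  and the plaquettes march one column per arc westwards or eastwards (`YBWalk.exists_run_start`, `run_W/run_E`).
* ★★★ `ΩG.top_turns_le_two` / `ΩG.bottom_turns_le_two`: consequently every `[corner]`/`[coCorner]` plaquette of the walk in an extreme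
  row is the entry or the exit plaquette of that run (interior plaquettes are singly visited with a straight arc, `[straight]`): at
  most TWO isolated turns per extreme row.
* ★★★ `ΩG.turn_profile_of_cost_five`: a cost-`5` wound class-`B2a` walk has EXACTLY two isolated turns in the top row, exactly two in
  the bottom row, at most one strictly between, and none there when its end side is vertical.

So a level-`5` class-`B2a` member is a «rectangle up to the middle»: one straight top run and one straight bottom run between their
corner turns, plus at most one more isolated turn; the doubly visited plaquettes and the middle rows are not constrained here.
[GlazmanManolescu2019 §1 Fig. 1, Lemma 2.1, Remark 2.2; Glazman 2015 Lemma 3.1 (proof, pp. 6–7); Courant–Robbins, even–odd rule]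
-/

noncomputable section

namespace Literature.Probability.RandomPlanarGeometry.SAW.YangBaxter

open Real
open Literature.Barriers.CriticalPhenomena.PlaquetteWalk

open private fc_fh fc_ne fh_add_Mv three_le_Mv from Literature.Probability.RandomPlanarGeometry.YangBaxterSAWGeneralDomain

namespace YBWalk

variable {D : Set Face} {a z : MidEdge} (γ : YBWalk D a z)

/-- A visited plaquette of the mid-edge list of a walk is the plaquette of one of its arcs. [cite: GlazmanManolescu2019, §1, Fig. 1 (lane plumbing)] -/
theorem exists_fc_eq_of_mem_facesL {f : Face} (hf : f ∈ facesL γ.mids) : ∃ m, m < γ.arcs.length ∧ γ.fc m = f := by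
  unfold facesL at hf
  rw [List.mem_dedup, List.mem_filterMap] at hf
  obtain ⟨p, hp, hpf⟩ := hf
  obtain ⟨m, hm, hpm⟩ := List.getElem_of_mem hp
  refine ⟨m, hm, ?_⟩
  have h1 := (γ.arcKindOf_getElem hm).1
  have h2 : γ.arcs[m] = p := hpm
  rw [h2, hpf] at h1
  exact (Option.some_injective _ h1).symm

end YBWalk

namespace ΩG

variable {D : Set Face} {w r : Face} {ω : ΩG D (w.side .W) r}

/-- ★★★ **THE SHAPE OF THE TOP RUN AT COST `≤ 6`.** For a wound class-`B2a` walk from the hole root `w.side W` of limit cost `≤ 6`, the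
topmost row `Y > w.2` is visited exactly by the arcs of ONE run `j₀ ≤ m ≤ i₁` with `1 ≤ j₀ < i₁`: the first enters from BELOW (`S → W/E`, an
entry turn), the last leaves DOWNWARDS (`W/E → S`, an exit turn — possibly the walk's last arc), every arc strictly between them is a
STRAIGHT horizontal arc, and the run marches one column per arc, westwards or eastwards.
[cite: GlazmanManolescu2019, §1, Fig. 1; Lemma 2.1; Remark 2.2] [cite: Glazman2015WeightedSAW, Lemma 3.1 (proof, pp. 6–7)]
[cite: CourantRobbins1958, Ch. V Appendix §2 (the even–odd rule)] -/
theorem top_run_shape (hh : holeFaceW w ∉ D) (hr : RootedFace D (w.side .W) r) (h : ω.IsB2a)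
    (hA : ω.AJ hr h (toC (midPt (w.side .W))) ≠ 0) (hc : cost (slotOfSide ω.1) ω.2.mids ≤ 6) :
    ∃ Y : ℤ, w.2 < Y ∧ (∀ j < ω.2.arcs.length, (ω.2.fc j).2 ≤ Y) ∧
      ∃ j₀ i₁, 1 ≤ j₀ ∧ j₀ < i₁ ∧ i₁ < ω.2.arcs.length ∧
        (∀ m < ω.2.arcs.length, (ω.2.fc m).2 = Y ↔ (j₀ ≤ m ∧ m ≤ i₁)) ∧
        ω.2.sIn j₀ = .S ∧ (ω.2.sOut j₀ = .W ∨ ω.2.sOut j₀ = .E) ∧ ω.2.sOut i₁ = .S ∧ (ω.2.sIn i₁ = .W ∨ ω.2.sIn i₁ = .E) ∧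
        (∀ m, j₀ < m → m < i₁ → arcKind (ω.2.sIn m) (ω.2.sOut m) = .straight) ∧
        (((∀ m, j₀ ≤ m → m < i₁ → ω.2.sOut m = .W) ∧ (ω.2.fc i₁).1 + (i₁ - j₀ : ℕ) = (ω.2.fc j₀).1) ∨
          ((∀ m, j₀ ≤ m → m < i₁ → ω.2.sOut m = .E) ∧ (ω.2.fc i₁).1 = (ω.2.fc j₀).1 + (i₁ - j₀ : ℕ))) := by
  classical
  obtain ⟨Y, hYw, hY, i₀, i₁, -, hi₀2, hrow₀, -, -, -, hi₁, hrow₁, hmax, halt⟩ := top_exit_or_end hh hr h hA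
  have hlen : 0 < ω.2.arcs.length := by omega
  have h0 : ω.2.fc 0 = w := fc_zero_eq_root w hh ω.2 hlen
  have hne := forall_top_ne_N hh hr h hY (by omega)
  -- the last top arc is an exit turn (no sideways end at cost ≤ 6)
  have hexit : ω.2.sOut i₁ = .S ∧ (ω.2.sIn i₁ = .W ∨ ω.2.sIn i₁ = .E) := by
    rcases halt with ⟨hS, hWE, -, -⟩ | ⟨-, hz, hrY⟩
    · exact ⟨hS, hWE⟩
    · exact absurd ⟨hz, hrY⟩ (not_end_in_top_row_of_cost_le_six hh hr h hA hc hY)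
  -- the run through `i₁`
  obtain ⟨j₀, hj₀1, hj₀i, hrun, hprev, hSN₀, hdir⟩ := ω.2.exists_run_start hi₁ (by rw [h0, hrow₁]; omega)
  have hrowj₀ : (ω.2.fc j₀).2 = Y := (hrun j₀ le_rfl hj₀i).trans hrow₁
  have hS₀ : ω.2.sIn j₀ = .S := by
    rcases hSN₀ with e | e
    · exact e
    · exact absurd e (hne j₀ (by omega) hrowj₀).1
  have hWE₀ : ω.2.sOut j₀ = .W ∨ ω.2.sOut j₀ = .E := by
    have hsd := ω.2.sIn_ne_sOut (show j₀ < ω.2.arcs.length by omega)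
    rw [hS₀] at hsd
    cases hs : ω.2.sOut j₀
    · exact Or.inl rfl
    · exact Or.inr rfl
    · exact absurd hs.symm hsd
    · exact absurd hs (hne j₀ (by omega) hrowj₀).2
  have hj₀i₁ : j₀ < i₁ := by
    rcases Nat.lt_or_ge j₀ i₁ with hlt | hge
    · exact hlt
    · exfalso
      have e : j₀ = i₁ := by omega
      rcases hexit.2 with e' | e' <;> rw [← e, hS₀] at e' <;> exact absurd e' (by decide)
  -- the interval
  have hint : ∀ m < ω.2.arcs.length, (ω.2.fc m).2 = Y ↔ (j₀ ≤ m ∧ m ≤ i₁) := by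
    intro m hm
    constructor
    · intro hrowm
      refine ⟨?_, ?_⟩
      · by_contra hlt
        have := top_row_interval_of_cost_le_six hh hr h hA hc hY (i := m) (j := j₀ - 1) (k := i₁) (by omega) (by omega) hi₁
          hrowm hrow₁
        exact hprev (this.trans hrow₁.symm)
      · by_contra hlt
        exact hmax m (by omega) hm hrowm
    · rintro ⟨h1, h2⟩
      exact (hrun m h1 h2).trans hrow₁
  -- interior arcs are straight
  have hstraight : ∀ m, j₀ < m → m < i₁ → arcKind (ω.2.sIn m) (ω.2.sOut m) = .straight := by
    intro m h1 h2
    rcases hdir with ⟨hallW, -⟩ | ⟨hallE, -⟩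
    · have hout : ω.2.sOut m = .W := hallW m (by omega) h2
      obtain ⟨-, hin⟩ := ω.2.fc_succ_eq_of_sOut_W (i := m - 1) (by omega) (hallW (m - 1) (by omega) (by omega))
      rw [show m - 1 + 1 = m by omega] at hin
      rw [hin, hout]; rfl
    · have hout : ω.2.sOut m = .E := hallE m (by omega) h2
      obtain ⟨-, hin⟩ := ω.2.fc_succ_eq_of_sOut_E (i := m - 1) (by omega) (hallE (m - 1) (by omega) (by omega))
      rw [show m - 1 + 1 = m by omega] at hin
      rw [hin, hout]; rfl
  exact ⟨Y, by omega, hY, j₀, i₁, hj₀1, hj₀i₁, hi₁, hint, hS₀, hWE₀, hexit.1, hexit.2, hstraight, hdir⟩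

/-- ★★★ **EXACTLY TWO ISOLATED TURNS IN THE TOP ROW AT COST `≤ 6`**: every `[corner]`/`[coCorner]` plaquette of the walk in its topmost
row is the entry plaquette or the exit plaquette of the top run; a finset of such plaquettes has at most two elements.
[cite: GlazmanManolescu2019, §1, Fig. 1 and eq. (1); Lemma 2.1] -/
theorem top_turns_le_two (hh : holeFaceW w ∉ D) (hr : RootedFace D (w.side .W) r) (h : ω.IsB2a)
    (hA : ω.AJ hr h (toC (midPt (w.side .W))) ≠ 0) (hc : cost (slotOfSide ω.1) ω.2.mids ≤ 6) {Y : ℤ}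
    (hY : ∀ j < ω.2.arcs.length, (ω.2.fc j).2 ≤ Y) (T : Finset Face)
    (hT : ∀ f ∈ T, f ∈ facesL ω.2.mids ∧ (kindsL ω.2.mids f = [.corner] ∨ kindsL ω.2.mids f = [.coCorner]))
    (hTY : ∀ f ∈ T, f.2 = Y) : T.card ≤ 2 := by
  classical
  obtain ⟨Y₀, hY₀w, hY₀, j₀, i₁, hj₀1, hj₀i₁, hi₁, hint, hS₀, -, hS₁, -, hstraight, -⟩ := top_run_shape hh hr h hA hc
  -- every element of `T` is `fc j₀` or `fc i₁`
  have hsub : T ⊆ {ω.2.fc j₀, ω.2.fc i₁} := by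
    intro f hf
    obtain ⟨hfm, hk⟩ := hT f hf
    obtain ⟨m, hm, rfl⟩ := ω.2.exists_fc_eq_of_mem_facesL hfm
    have hrowm : (ω.2.fc m).2 = Y₀ := by
      have e := hTY _ hf
      -- `Y = Y₀`: both are the top row (the plaquette `fc m` lies in row `Y` and all rows are `≤ Y₀`, `≤ Y`)
      have h1 := hY₀ m hm; have h2 := hY j₀ (by omega)
      have h3 : (ω.2.fc j₀).2 = Y₀ := (hint j₀ (by omega)).2 ⟨le_rfl, by omega⟩
      omega
    obtain ⟨h1, h2⟩ := (hint m hm).1 hrowm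
    have hsv : ∀ j < ω.2.arcs.length, ω.2.fc j = ω.2.fc m → j = m := fun j hj he =>
      (top_single_visit hh hr h hY₀ hY₀w hm hj hrowm he.symm).symm
    rw [Finset.mem_insert, Finset.mem_singleton]
    rcases Nat.lt_or_ge j₀ m with hlt | hge
    · rcases Nat.lt_or_ge m i₁ with hlt' | hge'
      · -- interior: the plaquette is singly visited with a straight arc
        exfalso
        have hks := ω.2.kindsL_eq_singleton_of_single_visit hm hsv
        rw [hstraight m hlt hlt'] at hks
        rcases hk with hk | hk <;> rw [hks] at hk <;> exact absurd hk (by decide)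
      · exact Or.inr (by rw [show m = i₁ by omega])
    · exact Or.inl (by rw [show m = j₀ by omega])
  exact (Finset.card_le_card hsub).trans (Finset.card_le_two)

/-! ## The bottom-row twins -/

/-- ★★★ **THE SHAPE OF THE BOTTOM RUN AT COST `≤ 6`** (twin). For a wound class-`B2a` walk from the hole root `w.side W` of limit cost `≤ 6`, the
bottommost row `Y < w.2` is visited exactly by the arcs of ONE run `j₀ ≤ m ≤ i₁` with `1 ≤ j₀ < i₁`: the first enters from ABOVE (`N → W/E`),
the last leaves UPWARDS (`W/E → N`, possibly the walk's last arc), every arc strictly between is a STRAIGHT horizontal arc, and the run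
marches one column per arc.
[cite: GlazmanManolescu2019, §1, Fig. 1; Lemma 2.1; Remark 2.2] [cite: Glazman2015WeightedSAW, Lemma 3.1 (proof, pp. 6–7)]
[cite: CourantRobbins1958, Ch. V Appendix §2 (the even–odd rule)] -/
theorem bottom_run_shape (hh : holeFaceW w ∉ D) (hr : RootedFace D (w.side .W) r) (h : ω.IsB2a)
    (hA : ω.AJ hr h (toC (midPt (w.side .W))) ≠ 0) (hc : cost (slotOfSide ω.1) ω.2.mids ≤ 6) :
    ∃ Y : ℤ, Y < w.2 ∧ (∀ j < ω.2.arcs.length, Y ≤ (ω.2.fc j).2) ∧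
      ∃ j₀ i₁, 1 ≤ j₀ ∧ j₀ < i₁ ∧ i₁ < ω.2.arcs.length ∧
        (∀ m < ω.2.arcs.length, (ω.2.fc m).2 = Y ↔ (j₀ ≤ m ∧ m ≤ i₁)) ∧
        ω.2.sIn j₀ = .N ∧ (ω.2.sOut j₀ = .W ∨ ω.2.sOut j₀ = .E) ∧ ω.2.sOut i₁ = .N ∧ (ω.2.sIn i₁ = .W ∨ ω.2.sIn i₁ = .E) ∧
        (∀ m, j₀ < m → m < i₁ → arcKind (ω.2.sIn m) (ω.2.sOut m) = .straight) ∧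
        (((∀ m, j₀ ≤ m → m < i₁ → ω.2.sOut m = .W) ∧ (ω.2.fc i₁).1 + (i₁ - j₀ : ℕ) = (ω.2.fc j₀).1) ∨
          ((∀ m, j₀ ≤ m → m < i₁ → ω.2.sOut m = .E) ∧ (ω.2.fc i₁).1 = (ω.2.fc j₀).1 + (i₁ - j₀ : ℕ))) := by
  classical
  obtain ⟨Y, hYw, hY, i₀, i₁, -, hi₀2, hrow₀, -, -, -, hi₁, hrow₁, hmax, halt⟩ := bottom_exit_or_end hh hr h hA
  have hlen : 0 < ω.2.arcs.length := by omega
  have h0 : ω.2.fc 0 = w := fc_zero_eq_root w hh ω.2 hlen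
  have hne := forall_bottom_ne_S hh hr h hY (by omega)
  -- the last bottom arc is an exit turn (no sideways end at cost ≤ 6)
  have hexit : ω.2.sOut i₁ = .N ∧ (ω.2.sIn i₁ = .W ∨ ω.2.sIn i₁ = .E) := by
    rcases halt with ⟨hS, hWE, -, -⟩ | ⟨-, hz, hrY⟩
    · exact ⟨hS, hWE⟩
    · exact absurd ⟨hz, hrY⟩ (not_end_in_bottom_row_of_cost_le_six hh hr h hA hc hY)
  -- the run through `i₁`
  obtain ⟨j₀, hj₀1, hj₀i, hrun, hprev, hSN₀, hdir⟩ := ω.2.exists_run_start hi₁ (by rw [h0, hrow₁]; omega)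
  have hrowj₀ : (ω.2.fc j₀).2 = Y := (hrun j₀ le_rfl hj₀i).trans hrow₁
  have hS₀ : ω.2.sIn j₀ = .N := by
    rcases hSN₀ with e | e
    · exact absurd e (hne j₀ (by omega) hrowj₀).1
    · exact e
  have hWE₀ : ω.2.sOut j₀ = .W ∨ ω.2.sOut j₀ = .E := by
    have hsd := ω.2.sIn_ne_sOut (show j₀ < ω.2.arcs.length by omega)
    rw [hS₀] at hsd
    cases hs : ω.2.sOut j₀
    · exact Or.inl rfl
    · exact Or.inr rfl
    · exact absurd hs (hne j₀ (by omega) hrowj₀).2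
    · exact absurd hs.symm hsd
  have hj₀i₁ : j₀ < i₁ := by
    rcases Nat.lt_or_ge j₀ i₁ with hlt | hge
    · exact hlt
    · exfalso
      have e : j₀ = i₁ := by omega
      rcases hexit.2 with e' | e' <;> rw [← e, hS₀] at e' <;> exact absurd e' (by decide)
  -- the interval
  have hint : ∀ m < ω.2.arcs.length, (ω.2.fc m).2 = Y ↔ (j₀ ≤ m ∧ m ≤ i₁) := by
    intro m hm
    constructor
    · intro hrowm
      refine ⟨?_, ?_⟩
      · by_contra hlt
        have := bottom_row_interval_of_cost_le_six hh hr h hA hc hY (i := m) (j := j₀ - 1) (k := i₁) (by omega) (by omega) hi₁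
          hrowm hrow₁
        exact hprev (this.trans hrow₁.symm)
      · by_contra hlt
        exact hmax m (by omega) hm hrowm
    · rintro ⟨h1, h2⟩
      exact (hrun m h1 h2).trans hrow₁
  -- interior arcs are straight
  have hstraight : ∀ m, j₀ < m → m < i₁ → arcKind (ω.2.sIn m) (ω.2.sOut m) = .straight := by
    intro m h1 h2
    rcases hdir with ⟨hallW, -⟩ | ⟨hallE, -⟩
    · have hout : ω.2.sOut m = .W := hallW m (by omega) h2
      obtain ⟨-, hin⟩ := ω.2.fc_succ_eq_of_sOut_W (i := m - 1) (by omega) (hallW (m - 1) (by omega) (by omega))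
      rw [show m - 1 + 1 = m by omega] at hin
      rw [hin, hout]; rfl
    · have hout : ω.2.sOut m = .E := hallE m (by omega) h2
      obtain ⟨-, hin⟩ := ω.2.fc_succ_eq_of_sOut_E (i := m - 1) (by omega) (hallE (m - 1) (by omega) (by omega))
      rw [show m - 1 + 1 = m by omega] at hin
      rw [hin, hout]; rfl
  exact ⟨Y, by omega, hY, j₀, i₁, hj₀1, hj₀i₁, hi₁, hint, hS₀, hWE₀, hexit.1, hexit.2, hstraight, hdir⟩

/-- ★★★ **EXACTLY TWO ISOLATED TURNS IN THE BOTTOM ROW AT COST `≤ 6`** (twin): every `[corner]`/`[coCorner]` plaquette of the walk in its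
bottommost row is the entry or the exit plaquette of the bottom run.
[cite: GlazmanManolescu2019, §1, Fig. 1 and eq. (1); Lemma 2.1] -/
theorem bottom_turns_le_two (hh : holeFaceW w ∉ D) (hr : RootedFace D (w.side .W) r) (h : ω.IsB2a)
    (hA : ω.AJ hr h (toC (midPt (w.side .W))) ≠ 0) (hc : cost (slotOfSide ω.1) ω.2.mids ≤ 6) {Y : ℤ}
    (hY : ∀ j < ω.2.arcs.length, Y ≤ (ω.2.fc j).2) (T : Finset Face)
    (hT : ∀ f ∈ T, f ∈ facesL ω.2.mids ∧ (kindsL ω.2.mids f = [.corner] ∨ kindsL ω.2.mids f = [.coCorner]))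
    (hTY : ∀ f ∈ T, f.2 = Y) : T.card ≤ 2 := by
  classical
  obtain ⟨Y₀, hY₀w, hY₀, j₀, i₁, hj₀1, hj₀i₁, hi₁, hint, hS₀, -, hS₁, -, hstraight, -⟩ := bottom_run_shape hh hr h hA hc
  -- every element of `T` is `fc j₀` or `fc i₁`
  have hsub : T ⊆ {ω.2.fc j₀, ω.2.fc i₁} := by
    intro f hf
    obtain ⟨hfm, hk⟩ := hT f hf
    obtain ⟨m, hm, rfl⟩ := ω.2.exists_fc_eq_of_mem_facesL hfm
    have hrowm : (ω.2.fc m).2 = Y₀ := by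
      have e := hTY _ hf
      -- `Y = Y₀`: both are the bottom row
      have h1 := hY₀ m hm; have h2 := hY j₀ (by omega)
      have h3 : (ω.2.fc j₀).2 = Y₀ := (hint j₀ (by omega)).2 ⟨le_rfl, by omega⟩
      omega
    obtain ⟨h1, h2⟩ := (hint m hm).1 hrowm
    have hsv : ∀ j < ω.2.arcs.length, ω.2.fc j = ω.2.fc m → j = m := fun j hj he =>
      (bottom_single_visit hh hr h hY₀ hY₀w hm hj hrowm he.symm).symm
    rw [Finset.mem_insert, Finset.mem_singleton]
    rcases Nat.lt_or_ge j₀ m with hlt | hge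
    · rcases Nat.lt_or_ge m i₁ with hlt' | hge'
      · -- interior: the plaquette is singly visited with a straight arc
        exfalso
        have hks := ω.2.kindsL_eq_singleton_of_single_visit hm hsv
        rw [hstraight m hlt hlt'] at hks
        rcases hk with hk | hk <;> rw [hks] at hk <;> exact absurd hk (by decide)
      · exact Or.inr (by rw [show m = i₁ by omega])
    · exact Or.inl (by rw [show m = j₀ by omega])
  exact (Finset.card_le_card hsub).trans (Finset.card_le_two)

/-- ★★★ **THE ISOLATED-TURN PROFILE OF A COST-`5` WOUND WALK**: exactly TWO `[corner]`/`[coCorner]` plaquettes in the topmost row (the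
entry and the exit of the single top run), exactly TWO in the bottommost row, hence (from `n_{u₁} + n_{u₂} = 5 − [z vertical]`) at
most ONE strictly between the extreme rows and NONE there when the end side `z` is vertical. In finset form: every finset of
isolated-turn plaquettes of the walk in the top row (bottom row; strictly between) has at most `2` (`2`; `slotDeg (slotOfSide z)`)
elements, and some have exactly `2` (`2`). [cite: GlazmanManolescu2019, §1, Fig. 1 and eq. (1); Lemma 2.1; Remark 2.2]
[cite: Glazman2015WeightedSAW, Lemma 3.1 (proof, pp. 6–7)] [cite: CourantRobbins1958, Ch. V Appendix §2 (the even–odd rule)] -/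
theorem turn_profile_of_cost_five (hh : holeFaceW w ∉ D) (hr : RootedFace D (w.side .W) r) (h : ω.IsB2a)
    (hA : ω.AJ hr h (toC (midPt (w.side .W))) ≠ 0) (hc : cost (slotOfSide ω.1) ω.2.mids = 5) :
    ∃ Y Y' : ℤ, Y' < w.2 ∧ w.2 < Y ∧ (∀ j < ω.2.arcs.length, (ω.2.fc j).2 ≤ Y) ∧ (∀ j < ω.2.arcs.length, Y' ≤ (ω.2.fc j).2) ∧
      (∀ T : Finset Face,
        (∀ f ∈ T, f ∈ facesL ω.2.mids ∧ (kindsL ω.2.mids f = [.corner] ∨ kindsL ω.2.mids f = [.coCorner])) →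
        ((∀ f ∈ T, f.2 = Y) → T.card ≤ 2) ∧ ((∀ f ∈ T, f.2 = Y') → T.card ≤ 2) ∧
        ((∀ f ∈ T, Y' < f.2 ∧ f.2 < Y) → T.card ≤ slotDeg (slotOfSide ω.1))) ∧
      (∃ T₁ T₂ : Finset Face,
        (∀ f ∈ T₁, f ∈ facesL ω.2.mids ∧ (kindsL ω.2.mids f = [.corner] ∨ kindsL ω.2.mids f = [.coCorner])) ∧
        (∀ f ∈ T₂, f ∈ facesL ω.2.mids ∧ (kindsL ω.2.mids f = [.corner] ∨ kindsL ω.2.mids f = [.coCorner])) ∧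
        (∀ f ∈ T₁, f.2 = Y) ∧ (∀ f ∈ T₂, f.2 = Y') ∧ T₁.card = 2 ∧ T₂.card = 2) := by
  classical
  obtain ⟨Y, Y', hY'w, hYw, hY, hY', T₁, T₂, hT₁, hT₂, hr₁, hr₂, hc₁, hc₂, hmid⟩ := isolated_turns_of_cost_five hh hr h hA hc
  have ht₁ := top_turns_le_two hh hr h hA (by omega) hY T₁ hT₁ hr₁
  have ht₂ := bottom_turns_le_two hh hr h hA (by omega) hY' T₂ hT₂ hr₂
  have hs : slotDeg (slotOfSide ω.1) ≤ 1 := by unfold slotDeg; split_ifs <;> omega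
  refine ⟨Y, Y', hY'w, hYw, hY, hY', fun T hT => ⟨fun hTY => top_turns_le_two hh hr h hA (by omega) hY T hT hTY,
    fun hTY => bottom_turns_le_two hh hr h hA (by omega) hY' T hT hTY, fun hTm => ?_⟩,
    T₁, T₂, hT₁, hT₂, hr₁, hr₂, by omega, by omega⟩
  have := hmid T hT hTm
  omega

end ΩG

end Literature.Probability.RandomPlanarGeometry.SAW.YangBaxter
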